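import Mathlib.RingTheory.MvPolynomial.Homogeneous
import Mathlib.Algebra.MvPolynomial.Funext
import Mathlib.LinearAlgebra.Basis.VectorSpace
import Mathlib.LinearAlgebra.FiniteDimensional.Defs
import Mathlib.LinearAlgebra.Dimension.Constructions
import HarnessLib

/-!
# A polynomial vanishing on a linear subspace lies in the ideal of that subspace

Over an INFINITE field `k` (polynomials are determined by their values, Mathlib
`MvPolynomial.funext`), for a linear subspace `W ⊆ kᴺ⁺¹` spanned by `u` linearly independent
vectors `w₀, …, w_{u-1}` and a polynomial `F ∈ k[x₀, …, x_N]` vanishing at every point of `W`,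
there are `t = N + 1 - u` linearly independent linear forms `L₁, …, L_t` (cutting out `W`) with
`F ∈ (L₁, …, L_t)` (`exists_linearForms_mem_ideal_span_of_forall_eval_eq_zero`). This is the
algebraic half of "the linear subspace `ℙ(W) ⊆ ℙᴺ` lies on the hypersurface `V₊(F)` iff `F` lies
in the homogeneous prime `(L₁, …, L_t)` of `ℙ(W)`", used to turn the planes found on cubic forms
(`Literature/RingTheory/MvPolynomial/CubicFormLinearSubspaces.lean`) into plane points of cubic
hypersurfaces (`Literature.AlgebraicGeometry.Motives.IsLinearSubspacePoint`).

Steps (all [folklore]):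
* `mem_ideal_span_X_image_of_forall_eval_eq_zero` — **Lemma V, coordinate form**: if `G`
  vanishes on the coordinate subspace `{x : x_i = 0, i ∈ T}` then `G ∈ (x_i : i ∈ T)`:
  `G - G|_{x_T = 0}` lies in the ideal (`sub_aeval_ite_mem_ideal_span`, induction on `G`) and
  `G|_{x_T = 0}` vanishes identically, hence is `0`.
* the **coordinate forms** `ℓ_i = Σ_m (b.repr e_m)_i x_m` of a basis `b` of `kᴺ⁺¹`
  (`eval_coordForm`: `ℓ_i(v) = (b.repr v)_i`; linear, `isHomogeneous_coordForm`; linearly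
  independent, `linearIndependent_coordForm`) and the two substitutions `x_i ↦ ℓ_i`,
  `x_m ↦ Σ_i (b i)_m x_i`, inverse to each other on `k[x₀, …, x_N]`
  (`aeval_coordForm_aeval_basisForm`, checked on values), whence the transport of Lemma V to
  an arbitrary basis (`mem_ideal_span_coordForm_of_forall_eval_eq_zero`);
* a basis extending the `w_j` (Mathlib `Module.Basis.extend`), the count `#(new vectors) =
  N + 1 - u`, and a reindexing by `Fin t`.
-/

noncomputable section

open _root_.MvPolynomial

namespace Literature.RingTheory.MvPolynomial

universe u

variable {k : Type u} [Field k]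

/-! ### Lemma V: vanishing on a coordinate subspace -/

section Coordinate

variable {σ τ : Type*}

/-- Evaluating a substitution: `(G ∘ g)(x) = G(g(x))`. [folklore] -/
theorem eval_aeval_eq_eval (g : σ → MvPolynomial τ k) (x : τ → k) (G : MvPolynomial σ k) :
    eval x (aeval g G) = eval (fun i => eval x (g i)) G := by
  induction G using MvPolynomial.induction_on with
  | C a => simp
  | add p q hp hq => simp only [map_add, hp, hq]
  | mul_X p i hp => simp only [map_mul, hp, aeval_X, eval_X]

/-- `G - G|_{x_T = 0}` lies in the ideal `(x_i : i ∈ T)`. [folklore] -/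
theorem sub_aeval_ite_mem_ideal_span (T : Set σ) [DecidablePred (· ∈ T)] (G : MvPolynomial σ k) :
    G - aeval (fun i => if i ∈ T then (0 : MvPolynomial σ k) else X i) G ∈
      Ideal.span (X '' T) := by
  induction G using MvPolynomial.induction_on with
  | C a =>
    rw [algHom_C, algebraMap_eq, sub_self]
    exact Ideal.zero_mem _
  | add p q hp hq =>
    have h : p + q - aeval (fun i => if i ∈ T then (0 : MvPolynomial σ k) else X i) (p + q) =
        (p - aeval (fun i => if i ∈ T then (0 : MvPolynomial σ k) else X i) p) +
          (q - aeval (fun i => if i ∈ T then (0 : MvPolynomial σ k) else X i) q) := by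
      rw [map_add]; ring
    rw [h]
    exact Ideal.add_mem _ hp hq
  | mul_X p i hp =>
    rw [map_mul, aeval_X]
    split_ifs with hi
    · rw [mul_zero, sub_zero]
      exact Ideal.mul_mem_left _ _ (Ideal.subset_span ⟨i, hi, rfl⟩)
    · have h : p * X i - aeval (fun i => if i ∈ T then (0 : MvPolynomial σ k) else X i) p * X i =
          (p - aeval (fun i => if i ∈ T then (0 : MvPolynomial σ k) else X i) p) * X i := by
        ring
      rw [h]
      exact Ideal.mul_mem_right _ _ hp

/-- **Lemma V (coordinate form).** Over an infinite field, a polynomial vanishing at every point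
of the coordinate subspace `{x : x_i = 0 for i ∈ T}` lies in the ideal `(x_i : i ∈ T)`: the
difference `G - G|_{x_T = 0}` lies in the ideal, and `G|_{x_T = 0}` vanishes everywhere, hence is
the zero polynomial (`MvPolynomial.funext`). [folklore] -/
theorem mem_ideal_span_X_image_of_forall_eval_eq_zero [Infinite k] (T : Set σ)
    (G : MvPolynomial σ k) (hG : ∀ x : σ → k, (∀ i ∈ T, x i = 0) → eval x G = 0) :
    G ∈ Ideal.span (X '' T) := by
  classical
  have hπ : aeval (fun i => if i ∈ T then (0 : MvPolynomial σ k) else X i) G = 0 := by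
    apply MvPolynomial.funext
    intro x
    rw [eval_aeval_eq_eval, map_zero]
    refine hG _ fun i hi => ?_
    simp [hi]
  have h := sub_aeval_ite_mem_ideal_span T G
  rwa [hπ, sub_zero] at h

end Coordinate

/-! ### Coordinate linear forms of a basis and the ideal of a subspace -/

section Basis

variable {N : ℕ} {ι : Type*}

/-- The `i`-th coordinate form of a basis `b` of `kᴺ⁺¹`, as a polynomial:
`ℓ_i = Σ_m (b.repr e_m)_i X_m` evaluates to `v ↦ (b.repr v)_i`. [folklore] -/
theorem eval_coordForm (b : Module.Basis ι k (Fin (N + 1) → k)) (i : ι) (v : Fin (N + 1) → k) :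
    eval v (∑ m : Fin (N + 1), C (b.repr (Pi.single m 1) i) * X m) = b.repr v i := by
  classical
  simp only [map_sum, map_mul, eval_C, eval_X]
  have hv : v = ∑ m, v m • (Pi.single m (1 : k) : Fin (N + 1) → k) := by
    ext j
    simp [Finset.sum_apply, Pi.single_apply]
  conv_rhs => rw [hv, map_sum, Finsupp.finsetSum_apply]
  refine Finset.sum_congr rfl fun m _ => ?_
  rw [map_smul, Finsupp.smul_apply, smul_eq_mul, mul_comm]

/-- The coordinate forms are linear forms. [folklore] -/
theorem isHomogeneous_coordForm (b : Module.Basis ι k (Fin (N + 1) → k)) (i : ι) :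
    (∑ m : Fin (N + 1), C (b.repr (Pi.single m 1) i) * X m :
      MvPolynomial (Fin (N + 1)) k).IsHomogeneous 1 :=
  IsHomogeneous.sum _ _ _ fun _ _ => isHomogeneous_C_mul_X _ _

/-- The coordinate forms of a basis are linearly independent (evaluate a relation at the basis
vectors). [folklore] -/
theorem linearIndependent_coordForm (b : Module.Basis ι k (Fin (N + 1) → k)) :
    LinearIndependent k fun i : ι =>
      (∑ m : Fin (N + 1), C (b.repr (Pi.single m 1) i) * X m : MvPolynomial (Fin (N + 1)) k) := by
  classical
  rw [linearIndependent_iff']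
  intro s g hg i hi
  have h := congrArg (eval (b i)) hg
  rw [map_sum, map_zero] at h
  simp only [smul_eval, eval_coordForm, b.repr_self] at h
  rw [Finset.sum_eq_single i (fun j _ hji => by
    rw [Finsupp.single_apply, if_neg (Ne.symm hji), mul_zero]) (fun his => absurd hi his)] at h
  simpa using h

/-- Evaluating the substitution `X_i ↦ ℓ_i` (coordinate forms of `b`): `P(ℓ)(v) = P(b.repr v)`.
[folklore] -/
theorem eval_aeval_coordForm (b : Module.Basis ι k (Fin (N + 1) → k)) (P : MvPolynomial ι k)
    (v : Fin (N + 1) → k) :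
    eval v (aeval (fun i : ι =>
      (∑ m : Fin (N + 1), C (b.repr (Pi.single m 1) i) * X m : MvPolynomial (Fin (N + 1)) k)) P) =
      eval (fun i => b.repr v i) P := by
  rw [eval_aeval_eq_eval]
  simp only [eval_coordForm]

/-- Evaluating the substitution `X_m ↦ Σ_i (b i)_m X_i` (the inverse direction):
`F(Σ_i c_i b_i)`. [folklore] -/
theorem eval_aeval_basisForm [Fintype ι] (b : Module.Basis ι k (Fin (N + 1) → k))
    (F : MvPolynomial (Fin (N + 1)) k) (c : ι → k) :
    eval c (aeval (fun m : Fin (N + 1) => (∑ i : ι, C (b i m) * X i : MvPolynomial ι k)) F) =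
      eval (fun m => ∑ i, c i * b i m) F := by
  rw [eval_aeval_eq_eval]
  have h : (fun m : Fin (N + 1) => eval c (∑ i : ι, C (b i m) * X i : MvPolynomial ι k)) =
      fun m => ∑ i, c i * b i m := by
    funext m
    simp only [map_sum, map_mul, eval_C, eval_X, mul_comm (c _)]
  rw [h]

/-- The two substitutions are inverse to each other on the original ring (checked pointwise, so
stated over an infinite field): `F = (F(Σ_i X_i b_i))(X_i := ℓ_i)`. [folklore] -/
theorem aeval_coordForm_aeval_basisForm [Fintype ι] [Infinite k]
    (b : Module.Basis ι k (Fin (N + 1) → k)) (F : MvPolynomial (Fin (N + 1)) k) :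
    aeval (fun i : ι =>
      (∑ m : Fin (N + 1), C (b.repr (Pi.single m 1) i) * X m : MvPolynomial (Fin (N + 1)) k))
        (aeval (fun m : Fin (N + 1) => (∑ i : ι, C (b i m) * X i : MvPolynomial ι k)) F) = F := by
  apply MvPolynomial.funext
  intro v
  rw [eval_aeval_coordForm, eval_aeval_basisForm]
  have h : (fun m : Fin (N + 1) => ∑ i, b.repr v i * b i m) = v := by
    funext m
    have h' := congr_fun (b.sum_repr v) m
    rw [Finset.sum_apply] at h'
    simpa only [Pi.smul_apply, smul_eq_mul] using h'
  rw [h]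

/-- **A polynomial vanishing on a subspace spanned by part of a basis lies in the ideal of the
complementary coordinate forms.** If `F` vanishes at every `Σ_{i ∉ T} c_i b_i` then
`F ∈ (ℓ_i : i ∈ T)`. [folklore] -/
theorem mem_ideal_span_coordForm_of_forall_eval_eq_zero [Fintype ι] [Infinite k]
    (b : Module.Basis ι k (Fin (N + 1) → k)) (T : Set ι) (F : MvPolynomial (Fin (N + 1)) k)
    (hF : ∀ c : ι → k, (∀ i ∈ T, c i = 0) → eval (fun m => ∑ i, c i * b i m) F = 0) :
    F ∈ Ideal.span ((fun i : ι => (∑ m : Fin (N + 1), C (b.repr (Pi.single m 1) i) * X m :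
      MvPolynomial (Fin (N + 1)) k)) '' T) := by
  have hGT : aeval (fun m : Fin (N + 1) => (∑ i : ι, C (b i m) * X i : MvPolynomial ι k)) F ∈
      Ideal.span (X '' T) := by
    refine mem_ideal_span_X_image_of_forall_eval_eq_zero T _ fun c hc => ?_
    rw [eval_aeval_basisForm]
    exact hF c hc
  have h := Ideal.mem_map_of_mem (aeval (fun i : ι =>
    (∑ m : Fin (N + 1), C (b.repr (Pi.single m 1) i) * X m : MvPolynomial (Fin (N + 1)) k))) hGT
  rw [Ideal.map_span, Set.image_image, aeval_coordForm_aeval_basisForm] at h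
  simpa only [aeval_X] using h

end Basis

/-! ### From a vanishing subspace to the ideal form -/

section Family

variable {N u : ℕ}

/-- **A polynomial vanishing on the span of an independent family lies in the ideal of
`N + 1 - u` independent linear forms.** For `w₀, …, w_{u-1}` linearly independent in `kᴺ⁺¹`
(`k` infinite) and `F` vanishing on `span(w)`, there are `t = N + 1 - u` linearly independent
linear forms `L₁, …, L_t` with `F ∈ (L₁, …, L_t)`: the coordinate forms, along the new vectors,
of a basis extending the `w_j` (they cut out `span(w)`). [folklore] -/
theorem exists_linearForms_mem_ideal_span_of_forall_eval_eq_zero [Infinite k]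
    {F : MvPolynomial (Fin (N + 1)) k} {w : Fin u → Fin (N + 1) → k}
    (hw : LinearIndependent k w)
    (hv : ∀ v ∈ Submodule.span k (Set.range w), eval v F = 0) :
    ∃ (t : ℕ) (L : Fin t → MvPolynomial (Fin (N + 1)) k), t + u = N + 1 ∧
      LinearIndependent k L ∧ (∀ j, (L j).IsHomogeneous 1) ∧ F ∈ Ideal.span (Set.range L) := by
  classical
  -- extend `w` to a basis `b`, indexed by a set `E ⊇ range w` of vectors, `b i = i`
  have hli : LinearIndepOn k id (Set.range w) := hw.linearIndepOn_id
  have hsub : Set.range w ⊆ hli.extend (Set.subset_univ _) := hli.subset_extend _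
  set b := Module.Basis.extend hli with hb_def
  have hb : ∀ i, b i = (i : Fin (N + 1) → k) := Module.Basis.extend_apply_self hli
  haveI : Fintype ↥(hli.extend (Set.subset_univ _)) := FiniteDimensional.fintypeBasisIndex b
  -- the new basis vectors
  set T : Set ↥(hli.extend (Set.subset_univ _)) :=
    {i | (i : Fin (N + 1) → k) ∉ Set.range w} with hT
  -- `F` lies in the ideal of the coordinate forms along `T`
  have hmem : F ∈ Ideal.span ((fun i => ∑ m : Fin (N + 1), C (b.repr (Pi.single m 1) i) * X m) '' T) := by
    refine mem_ideal_span_coordForm_of_forall_eval_eq_zero b T F fun c hc => ?_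
    have hfun : (fun m => ∑ i, c i * b i m) = ∑ i, c i • (b i : Fin (N + 1) → k) := by
      funext m
      simp [Finset.sum_apply, Pi.smul_apply]
    rw [hfun]
    refine hv _ (Submodule.sum_mem _ fun i _ => ?_)
    by_cases hi : i ∈ T
    · rw [hc i hi, zero_smul]
      exact Submodule.zero_mem _
    · refine Submodule.smul_mem _ _ (Submodule.subset_span ?_)
      rw [hb]
      simpa [hT] using hi
  -- counting: `#E = N + 1`, `#Tᶜ = u`
  have hcardE : Fintype.card ↥(hli.extend (Set.subset_univ _)) = N + 1 := by
    have h := Module.finrank_eq_card_basis b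
    rwa [Module.finrank_fin_fun, eq_comm] at h
  have eT : ↥Tᶜ ≃ Fin u :=
    { toFun := fun i => (Equiv.ofInjective w hw.injective).symm
        ⟨(i.1 : Fin (N + 1) → k), by simpa [hT] using i.2⟩
      invFun := fun j => ⟨⟨w j, hsub ⟨j, rfl⟩⟩, by simp [hT]⟩
      left_inv := fun i => by
        apply Subtype.ext
        apply Subtype.ext
        exact Equiv.apply_ofInjective_symm hw.injective _
      right_inv := fun j => by
        simp only
        exact Equiv.ofInjective_symm_apply hw.injective j }
  have hcardTc : Fintype.card ↥Tᶜ = u := (Fintype.card_congr eT).trans (Fintype.card_fin u)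
  have hcompl := Fintype.card_compl_set T
  have hle : Fintype.card ↥T ≤ Fintype.card ↥(hli.extend (Set.subset_univ _)) :=
    set_fintype_card_le_univ T
  -- reindex `T` by `Fin t`
  let e : Fin (Fintype.card ↥T) ≃ ↥T := (Fintype.equivFin ↥T).symm
  refine ⟨Fintype.card ↥T,
    fun j => ∑ m : Fin (N + 1), C (b.repr (Pi.single m 1) (e j : ↥(hli.extend _))) * X m,
    by omega, ?_, fun j => isHomogeneous_coordForm b _, ?_⟩
  · exact ((linearIndependent_coordForm b).comp _ Subtype.val_injective).comp _ e.injective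
  · have hrange : Set.range (fun j => ∑ m : Fin (N + 1),
        C (b.repr (Pi.single m 1) (e j : ↥(hli.extend (Set.subset_univ _)))) * X m) =
        (fun i => ∑ m : Fin (N + 1), C (b.repr (Pi.single m 1) i) * X m) '' T := by
      ext p
      simp only [Set.mem_range, Set.mem_image]
      constructor
      · rintro ⟨j, rfl⟩
        exact ⟨e j, (e j).2, rfl⟩
      · rintro ⟨i, hi, rfl⟩
        exact ⟨e.symm ⟨i, hi⟩, by simp⟩
    rw [hrange]
    exact hmem

/-- **The same for a family of polynomials, with ONE system of linear forms**: for
`w₀, …, w_{u-1}` linearly independent in `kᴺ⁺¹` (`k` infinite) there are `t = N + 1 - u` linearly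
independent linear forms `L₁, …, L_t` such that EVERY polynomial vanishing on `span(w)` lies in
`(L₁, …, L_t)` (the `L_j` depend only on `w`: the coordinate forms of a basis extending the `w_j`
along the new vectors). This is the form needed for complete intersections `V₊(F₁, …, F_c)`.
[folklore] -/
theorem exists_linearForms_forall_mem_ideal_span [Infinite k] {w : Fin u → Fin (N + 1) → k}
    (hw : LinearIndependent k w) :
    ∃ (t : ℕ) (L : Fin t → MvPolynomial (Fin (N + 1)) k), t + u = N + 1 ∧
      LinearIndependent k L ∧ (∀ j, (L j).IsHomogeneous 1) ∧
        ∀ F : MvPolynomial (Fin (N + 1)) k, (∀ v ∈ Submodule.span k (Set.range w), eval v F = 0) →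
          F ∈ Ideal.span (Set.range L) := by
  classical
  -- extend `w` to a basis `b`, indexed by a set `E ⊇ range w` of vectors, `b i = i`
  have hli : LinearIndepOn k id (Set.range w) := hw.linearIndepOn_id
  have hsub : Set.range w ⊆ hli.extend (Set.subset_univ _) := hli.subset_extend _
  set b := Module.Basis.extend hli with hb_def
  have hb : ∀ i, b i = (i : Fin (N + 1) → k) := Module.Basis.extend_apply_self hli
  haveI : Fintype ↥(hli.extend (Set.subset_univ _)) := FiniteDimensional.fintypeBasisIndex b
  -- the new basis vectors
  set T : Set ↥(hli.extend (Set.subset_univ _)) :=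
    {i | (i : Fin (N + 1) → k) ∉ Set.range w} with hT
  -- every `F` vanishing on `span w` lies in the ideal of the coordinate forms along `T`
  have hmem : ∀ F : MvPolynomial (Fin (N + 1)) k,
      (∀ v ∈ Submodule.span k (Set.range w), eval v F = 0) →
        F ∈ Ideal.span ((fun i => ∑ m : Fin (N + 1), C (b.repr (Pi.single m 1) i) * X m) '' T) := by
    intro F hv
    refine mem_ideal_span_coordForm_of_forall_eval_eq_zero b T F fun c hc => ?_
    have hfun : (fun m => ∑ i, c i * b i m) = ∑ i, c i • (b i : Fin (N + 1) → k) := by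
      funext m
      simp [Finset.sum_apply, Pi.smul_apply]
    rw [hfun]
    refine hv _ (Submodule.sum_mem _ fun i _ => ?_)
    by_cases hi : i ∈ T
    · rw [hc i hi, zero_smul]
      exact Submodule.zero_mem _
    · refine Submodule.smul_mem _ _ (Submodule.subset_span ?_)
      rw [hb]
      simpa [hT] using hi
  -- counting: `#E = N + 1`, `#Tᶜ = u`
  have hcardE : Fintype.card ↥(hli.extend (Set.subset_univ _)) = N + 1 := by
    have h := Module.finrank_eq_card_basis b
    rwa [Module.finrank_fin_fun, eq_comm] at h
  have eT : ↥Tᶜ ≃ Fin u :=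
    { toFun := fun i => (Equiv.ofInjective w hw.injective).symm
        ⟨(i.1 : Fin (N + 1) → k), by simpa [hT] using i.2⟩
      invFun := fun j => ⟨⟨w j, hsub ⟨j, rfl⟩⟩, by simp [hT]⟩
      left_inv := fun i => by
        apply Subtype.ext
        apply Subtype.ext
        exact Equiv.apply_ofInjective_symm hw.injective _
      right_inv := fun j => by
        simp only
        exact Equiv.ofInjective_symm_apply hw.injective j }
  have hcardTc : Fintype.card ↥Tᶜ = u := (Fintype.card_congr eT).trans (Fintype.card_fin u)
  have hcompl := Fintype.card_compl_set T
  have hle : Fintype.card ↥T ≤ Fintype.card ↥(hli.extend (Set.subset_univ _)) :=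
    set_fintype_card_le_univ T
  -- reindex `T` by `Fin t`
  let e : Fin (Fintype.card ↥T) ≃ ↥T := (Fintype.equivFin ↥T).symm
  have hrange : Set.range (fun j => ∑ m : Fin (N + 1),
      C (b.repr (Pi.single m 1) (e j : ↥(hli.extend (Set.subset_univ _)))) * X m) =
      (fun i => ∑ m : Fin (N + 1), C (b.repr (Pi.single m 1) i) * X m) '' T := by
    ext p
    simp only [Set.mem_range, Set.mem_image]
    constructor
    · rintro ⟨j, rfl⟩
      exact ⟨e j, (e j).2, rfl⟩
    · rintro ⟨i, hi, rfl⟩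
      exact ⟨e.symm ⟨i, hi⟩, by simp⟩
  refine ⟨Fintype.card ↥T,
    fun j => ∑ m : Fin (N + 1), C (b.repr (Pi.single m 1) (e j : ↥(hli.extend _))) * X m,
    by omega, ?_, fun j => isHomogeneous_coordForm b _, fun F hv => ?_⟩
  · exact ((linearIndependent_coordForm b).comp _ Subtype.val_injective).comp _ e.injective
  · rw [hrange]
    exact hmem F hv

end Family

end Literature.RingTheory.MvPolynomial

end
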